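import Summits.BirchSwinnertonDyer.Rank1Residual.Supersingular.MazurTateTwistedNonvanishingTower
import Summits.BirchSwinnertonDyer.Rank1Residual.Supersingular.SprungConstantTerm
import Literature.NumberTheory.EllipticCurves.KuriharaNumberKimStructureProofs
import HarnessLib

/-!
# A Mazur–Tate certificate forbids vanishing twists, part 4: the UNIT case (`λ♯ = λ♭ = 0`, analytic
# rank `0`) — no vanishing twist at all, and (under Kato's Cor. 14.3 (2)) `E(ℚ_n)` is torsion for every `n`
# (cell `b2b-bsdres`, supersingular family, prover B = unit `b2b-bsdres-additive-p3`, gen 6; part 4)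

HONEST FRAMING (run/shared/lean/b2b/bsd-rank1-residual/, verbatim in every file): the goal of the
cell is to DELETE the COMBINATION-SHAPED residual classes of the Birch–Swinnerton-Dyer formula for
ALL analytic-rank `≤ 1` elliptic curves over `ℚ` — "full BSD formula for every rank `≤ 1` curve in
class `C`" assembled STRICTLY from published theorems — so that the rank-`≤ 1` remainder becomes
exactly the CONSTRUCTION-SHAPED classes, which are TYPED (missing-input `Prop`s), NOT attempted.
This is not "finishing BSD". THEOREMS ONLY; the one NAMED FACT used (hypothesis `hK`) is the tree's
`kato_finite_chiPart_of_twistedLValue_ne_zero` (Kato, Astérisque 295, Cor. 14.3 (2); NOT proved in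
the tree), displayed. Nothing about any particular curve is asserted; nothing is booked.

## What this file proves

Parts 1–3 treat the layers `n ≥ 1` (non-trivial characters of `Γ`). When BOTH colours of THE Sprung
pair are UNITS of `Λ` (`μ(L♯) = λ(L♯) = 0 = μ(L♭) = λ(L♭)` — the census's rank-`0` "(0,0)" rows), the
trivial character is covered too:

* `ratPlusSymbol_zero_ne_zero_of_isUnit_chromaticL` — (P•) (gen 3, `constantCoeff_chromaticL_of_…`:
  `L•(0) = c• · [0]⁺_f`) gives `[0]⁺_f ≠ 0` from `L•` a unit, hence `L(E, 1) ≠ 0`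
  (`entireLFunction_one_ne_zero_of_isUnit_chromaticL`; `IsNewformOf.entireLFunction_one_ne_zero_of_…`).
* `isOfFinAddOrder_layer_of_isUnit_of_kato` (**under `hK`**): `p ≠ 2` good, `p ∣ a_p`, `f` the newform
  of `E`, THE Sprung pair with `L♯, L♭` units ⇒ for EVERY `n`, every point of `E(ℚ(ζ_{p^{n+1}}))`
  fixed by the Teichmüller automorphisms `σ_η` — every point of `E(ℚ_n)` — has finite order:
  **`E(ℚ_n)` is finite for all `n`** (with Mordell–Weil). Trivial character: `L(E,1) ≠ 0` re-levelled
  (`exists_continuation_twistedLSeries_one_of_entireLFunction_one_ne_zero`,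
  `exists_continuation_changeLevel_iff`); non-trivial: part 3 with `λ• = 0 ≤ p − 2`; then the tree's
  absolute theorem `isOfFinAddOrder_point_of_kato_of_twistedLValue_ne_zero`.
* `X8.isOfFinAddOrder_layer_of_kato` — the X8 reading.

READING (iw-2 `tables/ss_signed_by_epsilon.tsv`, two engines, μ = 0 throughout; nothing booked):
`(λ♯, λ♭) = (0, 0)` on 170 of the 286 analytic-rank-0 X8 pairs, 143/260 X7, 86/168 X6 — for these,
granted Kato's Cor. 14.3 (2), `E(ℚ_n)` is finite at every layer of the cyclotomic `ℤ_p`-tower (the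
effective form of Kato's Thm. 14.4 at these pairs). Not a BSD statement; labels unchanged.

References: Kato, Astérisque 295, Cor. 14.3 (2), Thm. 14.4; Sprung ANT 11 (2017) Cor. 4.11 (table);
Kurihara–Pollack 2007 §0.1; MTT 1986 §I.8. Memo: `HOME/b2b-bsdres-additive-p3/X8-ROUTE-B.md` §11.
-/

set_option autoImplicit false

noncomputable section

open scoped Classical MatrixGroups ModularForm

open CongruenceSubgroup Polynomial WeierstrassCurve WeierstrassCurve.Affine
  Literature.NumberTheory.EllipticCurves
  Literature.NumberTheory.EllipticCurves.ModularForms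
  Literature.NumberTheory.EllipticCurves.Sprung2017
  Literature.NumberTheory.EllipticCurves.Rank1Residual
  Summit.BirchSwinnertonDyer.Rank1Residual.X1.MuLambda

namespace Summit.BirchSwinnertonDyer.Rank1Residual.Supersingular

/-! ## §1. The trivial character: `L•` a unit ⇒ `L(E, 1) ≠ 0` -/

section Trivial

variable {W : WeierstrassCurve ℚ} [W.IsElliptic] [W.IsGloballyMinimal] {N : ℕ} [NeZero N]
  {f : CuspForm (Gamma0 N) 2} {p : ℕ} [hp : Fact p.Prime]

/-- **`L•` a unit of `Λ` ⇒ `[0]⁺_f ≠ 0`**, by the interpolation property at the trivial character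
`L•(0) = c• · [0]⁺_f` (gen 3, `constantCoeff_chromaticL_of_isSprungPair_of_isNewformOf`; Sprung's
table after Cor. 4.11). [cite: Sprung2017, Cor. 4.11 (table of special values)] -/
theorem ratPlusSymbol_zero_ne_zero_of_isUnit_chromaticL (hp2 : p ≠ 2) (hf : IsNewformOf W f)
    (hgood : W.HasGoodReductionAtPrime p) {Lsharp Lflat : IwasawaAlgebra p}
    (hSP : IsSprungPair f p (W.frobeniusTrace p) Lsharp Lflat) (c : Chroma)
    (hu : IsUnit (chromaticL c Lsharp Lflat)) : ratPlusSymbol f 0 ≠ 0 := by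
  have h := constantCoeff_chromaticL_of_isSprungPair_of_isNewformOf hp2 hf hgood hSP c
  have hc0 : ((PowerSeries.constantCoeff (chromaticL c Lsharp Lflat) : ℤ_[p]) : ℚ_[p]) ≠ 0 := by
    rw [Ne, ← map_zero (algebraMap ℤ_[p] ℚ_[p]), show ((PowerSeries.constantCoeff
      (chromaticL c Lsharp Lflat) : ℤ_[p]) : ℚ_[p]) = algebraMap ℤ_[p] ℚ_[p]
        (PowerSeries.constantCoeff (chromaticL c Lsharp Lflat)) from rfl,
      (IsFractionRing.injective ℤ_[p] ℚ_[p]).eq_iff]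
    exact (PowerSeries.isUnit_iff_constantCoeff.mp hu).ne_zero
  rw [h] at hc0
  intro h0
  rw [h0, Rat.cast_zero, mul_zero] at hc0
  exact hc0 rfl

/-- **`L•` a unit ⇒ `L(E, 1) ≠ 0`** (`IsNewformOf.entireLFunction_one_ne_zero_of_ratPlusSymbol_zero_ne_zero`).
[cite: Sprung2017, Cor. 4.11 (table of special values)] [cite: MazurTateTeitelbaum1986Invent, §I.8 (8.6)] -/
theorem entireLFunction_one_ne_zero_of_isUnit_chromaticL (hp2 : p ≠ 2) (hf : IsNewformOf W f)
    (hgood : W.HasGoodReductionAtPrime p) {Lsharp Lflat : IwasawaAlgebra p}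
    (hSP : IsSprungPair f p (W.frobeniusTrace p) Lsharp Lflat) (c : Chroma)
    (hu : IsUnit (chromaticL c Lsharp Lflat)) : W.entireLFunction 1 ≠ 0 :=
  hf.entireLFunction_one_ne_zero_of_ratPlusSymbol_zero_ne_zero
    (ratPlusSymbol_zero_ne_zero_of_isUnit_chromaticL hp2 hf hgood hSP c hu)

omit [W.IsGloballyMinimal] in
/-- **Trivial character datum at level `M`** from `L(E, 1) ≠ 0`: the mod-`M` series of the trivial
character has an entire continuation non-vanishing at `1` (level `1`:
`exists_continuation_twistedLSeries_one_of_entireLFunction_one_ne_zero`; level change: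
`exists_continuation_changeLevel_iff`, `changeLevel_one`). [cite: Kato2004Asterisque, §6.2 (p. 161)] -/
theorem exists_continuation_one_of_entireLFunction_one_ne_zero (hf : IsNewformOf W f)
    (h1 : W.entireLFunction 1 ≠ 0) (M : ℕ) [NeZero M] :
    ∃ L : ℂ → ℂ, Differentiable ℂ L ∧
      (∀ s : ℂ, 2 < s.re → L s = twistedLSeries f (1 : DirichletCharacter ℂ M) s) ∧ L 1 ≠ 0 := by
  have h := (exists_continuation_changeLevel_iff hf (one_dvd M) (1 : DirichletCharacter ℂ 1)).mpr
    (exists_continuation_twistedLSeries_one_of_entireLFunction_one_ne_zero hf h1)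
  rwa [DirichletCharacter.changeLevel_one] at h

end Trivial

/-! ## §2. `E(ℚ_n)` is torsion when both colours are units (under Kato's Cor. 14.3 (2)) -/

section Tower

variable {W : WeierstrassCurve ℚ} [W.IsElliptic] [W.IsGloballyMinimal] {N : ℕ} [NeZero N]
  {f : CuspForm (Gamma0 N) 2} {p : ℕ} [hp : Fact p.Prime]

set_option backward.isDefEq.respectTransparency false in
/-- **Both colours units ⇒ `E(ℚ_n)` torsion for every `n` (under Kato's Cor. 14.3 (2)).** `p ≠ 2`,
`E = W` globally minimal with good reduction at `p`, `p ∣ a_p`, `f` its newform, THE Sprung pair with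
`L♯ ≠ 0`, `μ(L♯) = λ(L♯) = 0` and `L♭ ≠ 0`, `μ(L♭) = λ(L♭) = 0`. Then, granted the vendored `hK`, for
every `n` every point of `E(ℚ(ζ_{p^{n+1}}))` fixed by the automorphisms acting on `μ_{p^{n+1}}` through a
Teichmüller unit — every point of `E(ℚ_n)` — has finite order. (Trivial character by §1; the others by
part 3, `exists_continuation_ne_zero_of_forall_layer` with parts 1–2 at `λ• = 0`; then
`isOfFinAddOrder_point_of_kato_of_twistedLValue_ne_zero`.) [cite: Kato2004Asterisque, Cor. 14.3 (2) (p. 235) and Thm. 14.4 (p. 236)] -/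
theorem isOfFinAddOrder_layer_of_isUnit_of_kato
    (hK : kato_finite_chiPart_of_twistedLValue_ne_zero) (hp2 : p ≠ 2) (hf : IsNewformOf W f)
    (hgood : W.HasGoodReductionAtPrime p) (hap : (p : ℤ) ∣ W.frobeniusTrace p)
    {Lsharp Lflat : IwasawaAlgebra p} (hSP : IsSprungPair f p (W.frobeniusTrace p) Lsharp Lflat)
    (hLs0 : Lsharp ≠ 0) (hμs : mu Lsharp = 0) (hls : lam Lsharp = 0)
    (hLf0 : Lflat ≠ 0) (hμf : mu Lflat = 0) (hlf : lam Lflat = 0)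
    {n : ℕ} [NeZero (p ^ (n + cyclotomicExponent p))]
    [DecidableEq (CyclotomicField (p ^ (n + cyclotomicExponent p)) ℚ)]
    {P : (W.baseChange (CyclotomicField (p ^ (n + cyclotomicExponent p)) ℚ)).toAffine.Point}
    (hP : ∀ σ : CyclotomicField (p ^ (n + cyclotomicExponent p)) ℚ ≃ₐ[ℚ]
        CyclotomicField (p ^ (n + cyclotomicExponent p)) ℚ,
      (∃ w : rootsOfUnity (torsionOrder p) ℤ_[p],
        IsCyclotomicExtension.autEquivPow (CyclotomicField (p ^ (n + cyclotomicExponent p)) ℚ)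
            (cyclotomic.irreducible_rat (NeZero.pos (p ^ (n + cyclotomicExponent p)))) σ =
          Units.map (PadicInt.toZModPow (n + cyclotomicExponent p)).toMonoidHom (w : ℤ_[p]ˣ)) →
      Point.map (W' := W.toAffine) (σ : CyclotomicField (p ^ (n + cyclotomicExponent p)) ℚ →ₐ[ℚ]
        CyclotomicField (p ^ (n + cyclotomicExponent p)) ℚ) P = P) :
    IsOfFinAddOrder P := by
  have hp2' : 2 ≤ p := hp.out.two_le
  -- the trivial character: `L(E, 1) ≠ 0` from `L♭` a unit
  have huf : IsUnit Lflat := (isUnit_iff_mu_eq_zero_and_lam_eq_zero Lflat).mpr ⟨hLf0, hμf, hlf⟩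
  have h1 : W.entireLFunction 1 ≠ 0 :=
    entireLFunction_one_ne_zero_of_isUnit_chromaticL hp2 hf hgood hSP Chroma.flat huf
  refine isOfFinAddOrder_point_of_kato_of_twistedLValue_ne_zero hK W hf
    {σ | ∃ w : rootsOfUnity (torsionOrder p) ℤ_[p],
      IsCyclotomicExtension.autEquivPow (CyclotomicField (p ^ (n + cyclotomicExponent p)) ℚ)
          (cyclotomic.irreducible_rat (NeZero.pos (p ^ (n + cyclotomicExponent p)))) σ =
        Units.map (PadicInt.toZModPow (n + cyclotomicExponent p)).toMonoidHom (w : ℤ_[p]ˣ)}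
    (fun χ hχH ↦ ?_) (fun σ hσ ↦ hP σ hσ)
  by_cases hχ1 : χ = 1
  · subst hχ1
    exact exists_continuation_one_of_entireLFunction_one_ne_zero hf h1 _
  · -- a non-trivial character trivial on the Teichmüller automorphisms is a character of `Γ`
    have hkill : ∀ w : rootsOfUnity (torsionOrder p) ℤ_[p],
        χ (PadicInt.toZModPow (n + cyclotomicExponent p) ((w : ℤ_[p]ˣ) : ℤ_[p])) = 1 := by
      intro w
      set e := IsCyclotomicExtension.autEquivPow (CyclotomicField (p ^ (n + cyclotomicExponent p)) ℚ)
        (cyclotomic.irreducible_rat (NeZero.pos (p ^ (n + cyclotomicExponent p)))) with he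
      have h1' := hχH (e.symm (Units.map (PadicInt.toZModPow (n + cyclotomicExponent p)).toMonoidHom
        (w : ℤ_[p]ˣ))) ⟨w, by rw [MulEquiv.apply_symm_apply]⟩
      have h2 := congrArg (fun u : ℂˣ ↦ (u : ℂ)) h1'
      simp only [Units.val_one] at h2
      rw [coe_cyclotomicCharacterOf_apply, ← he, MulEquiv.apply_symm_apply, Units.coe_map] at h2
      exact h2
    obtain ⟨hev, hord⟩ := even_and_orderOf_of_forall_apply_toZModPow χ hkill
    refine exists_continuation_ne_zero_of_forall_layer hp2 hf (fun k hk _ χ' hχ' hev' hord' L hLd hL ↦ ?_)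
      χ hχ1 hev hord
    rcases Nat.even_or_odd k with hke | hko
    · exact forall_even_twistedLValue_ne_zero_of_lam_flat_le hp2 hf hgood hap hSP hLf0 hμf
        (by rw [hlf, zero_add]; exact Nat.le_mul_of_pos_right p (by omega)) hke hk χ' hχ' hev' hord'
        hLd hL
    · exact forall_odd_twistedLValue_ne_zero_of_lam_sharp_le hp2 hf hgood hap hSP hLs0 hμs
        (by rw [hls, zero_add]; exact hp2') hko χ' hχ' hev' hord' hLd hL

end Tower

/-! ## §3. X8 reading -/

section X8

variable {W : WeierstrassCurve ℚ} [W.IsElliptic] [W.IsGloballyMinimal] {N : ℕ} [NeZero N]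
  {f : CuspForm (Gamma0 N) 2}

set_option backward.isDefEq.respectTransparency false in
/-- **X8 (`p = 3`, `a_3 = ±3`), both `L♯_3(E)`, `L♭_3(E)` units (`μ = λ = 0`; 170 of the 286
analytic-rank-0 pairs of the census): granted Kato's Cor. 14.3 (2), every point of `E(ℚ_n)` has finite
order, for every `n` — `E(ℚ_n)` is finite along the whole `ℤ_3`-tower.** Nothing booked; X8 stays
CONSTRUCTION-SHAPED. [cite: Kato2004Asterisque, Cor. 14.3 (2) (p. 235)] [cite: Sprung2017, Cor. 4.11 (table of special values)] -/
theorem X8.isOfFinAddOrder_layer_of_kato {p : ℕ} [Fact p.Prime]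
    (hK : kato_finite_chiPart_of_twistedLValue_ne_zero) (hX : ClassX8 W p) (hf : IsNewformOf W f)
    {Lsharp Lflat : IwasawaAlgebra p} (hSP : IsSprungPair f p (W.frobeniusTrace p) Lsharp Lflat)
    (hLs0 : Lsharp ≠ 0) (hμs : mu Lsharp = 0) (hls : lam Lsharp = 0)
    (hLf0 : Lflat ≠ 0) (hμf : mu Lflat = 0) (hlf : lam Lflat = 0)
    {n : ℕ} [NeZero (p ^ (n + cyclotomicExponent p))]
    [DecidableEq (CyclotomicField (p ^ (n + cyclotomicExponent p)) ℚ)]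
    {P : (W.baseChange (CyclotomicField (p ^ (n + cyclotomicExponent p)) ℚ)).toAffine.Point}
    (hP : ∀ σ : CyclotomicField (p ^ (n + cyclotomicExponent p)) ℚ ≃ₐ[ℚ]
        CyclotomicField (p ^ (n + cyclotomicExponent p)) ℚ,
      (∃ w : rootsOfUnity (torsionOrder p) ℤ_[p],
        IsCyclotomicExtension.autEquivPow (CyclotomicField (p ^ (n + cyclotomicExponent p)) ℚ)
            (cyclotomic.irreducible_rat (NeZero.pos (p ^ (n + cyclotomicExponent p)))) σ =
          Units.map (PadicInt.toZModPow (n + cyclotomicExponent p)).toMonoidHom (w : ℤ_[p]ˣ)) →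
      Point.map (W' := W.toAffine) (σ : CyclotomicField (p ^ (n + cyclotomicExponent p)) ℚ →ₐ[ℚ]
        CyclotomicField (p ^ (n + cyclotomicExponent p)) ℚ) P = P) :
    IsOfFinAddOrder P := by
  obtain ⟨hp3, ⟨hgood, hap⟩, -⟩ := hX
  subst hp3
  exact isOfFinAddOrder_layer_of_isUnit_of_kato hK (show (3 : ℕ) ≠ 2 by decide) hf hgood hap hSP hLs0
    hμs hls hLf0 hμf hlf hP

end X8

end Summit.BirchSwinnertonDyer.Rank1Residual.Supersingular

end
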